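import Literature.AlgebraicGeometry.Modules.FlatSectionsRegular
import Literature.AlgebraicGeometry.Resolution.StrictTransformIsBlowup
import Mathlib.RingTheory.DiscreteValuationRing.Basic
import HarnessLib

/-!
# [OURS · L1 W4.5(b) · EL♮(3) · LINE (T-j)-PROOF · BRICK S5b (K)] THE FLAT KERNEL: a function vanishing on the special fibre of a
# flat `O`-scheme is `ϖ` times a (unique) function

Crux chain w45b (cell `res-hironaka`, slot W4.5(b)), working crux **EL♮** = stmt-ResolutionOfSingularities-20038, child **EL♮(3)** =
stmt-ResolutionOfSingularities-20148, route EquisingularLift, line `sections`; residue (T-j) = F-102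
`Literature.AlgebraicGeometry.Resolution.GenusZeroOverCompleteDVR` (LINE (T-j)-PROOF, res-L1-w45b-lead-2 g3), brick S5b of its skeleton
(res-L1-w45b-stub-3 g7, CUT STATUS 2026-08-27T22:12:31Z «OPEN HAND → (K) flat kernel», signature VERBATIM). Written by res-L1-w45b-stub-4 g8.
HONEST FRAMING: OURS; NOT a statement of any manuscript; AI-written, weaker than expert review. No `sorry`; standard axioms; DEF-FREE.
`--supports stmt-ResolutionOfSingularities-20148 --as helper`.

SETTING. `O` a DVR with residue map `θ : O ↠ k`, `f : C → Spec O` FLAT, `(i, t)` a model square (`C_k = C ×_O Spec k`, `i : C_k → C`).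

THEOREM (`exists_eq_varpi_mul_of_appLE_eq_zero`). For any open `U ⊆ C` and `b ∈ Γ(C, U)` with `i♯ b = 0` on `i⁻¹U`, there is a
uniformiser `ϖ ∈ 𝔪_O` and `c ∈ Γ(C, U)` with `b = ϖ · c`.

PROOF. `ϖ` a uniformiser (`𝔪_O = (ϖ) = ker θ`). `i` is the base change of the closed immersion `Spec k → Spec O`, so
`ker i = (ker Spec θ)·𝒪_C` (Mathlib `ker_fst_of_isClosedImmersion`), and on an AFFINE `V ⊆ U` the kernel of `i♯ : Γ(C, V) → Γ(C_k, i⁻¹V)`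
is `(ker Spec θ)(⊤)·Γ(C, V) = (ϖ|_V)` (tree `ideal_comap_eq_map_of_le`, Mathlib `Scheme.Hom.ker_apply`); so `b|_V = ϖ c_V`. Since `f` is
flat and `ϖ ≠ 0` in the domain `O`, `ϖ` is a non-zero-divisor on `Γ(C, W)` for EVERY open `W` (tree `Modules/FlatSectionsRegular`,
`eq_zero_of_appLE_mul_eq_zero`), so the `c_V` are unique, agree on overlaps, and glue (sheaf condition over the affine opens of `U`) to
`c ∈ Γ(C, U)` with `b = ϖ c`. [cite: StacksProject, Tag 00HI] [cite: GortzWedhorn2020, Example 4.36 (p. 139)] [folklore]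
-/

noncomputable section

open CategoryTheory CategoryTheory.Limits AlgebraicGeometry TopologicalSpace Opposite IsLocalRing
open Literature.AlgebraicGeometry.Modules Literature.AlgebraicGeometry.Resolution

set_option linter.dupNamespace false

namespace Summit.ResolutionOfSingularities.ResolutionOfSingularities.Cruxes.EquisingularLiftNat.F102

universe u

/-- `Γ(Spec θ)` kills `x ∈ Γ(Spec R, ⊤)` iff `θ` kills its image in `R` (naturality of `ΓSpecIso`). [folklore] -/
theorem appTop_specMap_eq_zero_iff {R S : CommRingCat.{u}} (φ : R ⟶ S) (x : Γ(Spec R, ⊤)) :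
    (Spec.map φ).appTop x = 0 ↔ φ ((Scheme.ΓSpecIso R).hom x) = 0 := by
  have h : (Scheme.ΓSpecIso S).hom ((Spec.map φ).appTop x) = φ ((Scheme.ΓSpecIso R).hom x) := by
    rw [← CommRingCat.comp_apply, Scheme.ΓSpecIso_naturality, CommRingCat.comp_apply]
  constructor
  · intro hx
    rw [hx, map_zero] at h
    exact h.symm
  · intro hx
    rw [hx] at h
    have h' := congrArg (Scheme.ΓSpecIso S).inv h
    rw [Iso.hom_inv_id_apply, map_zero] at h'
    exact h'

/-- If `ker θ = (ϖ)` then the kernel of `Γ(Spec θ) : Γ(Spec R, ⊤) → Γ(Spec S, ⊤)` is generated by the image of `ϖ` under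
`ΓSpecIso⁻¹`. [folklore] -/
theorem ker_appTop_specMap_eq_span {R S : Type u} [CommRing R] [CommRing S] (θ : R →+* S) (ϖ : R)
    (hker : RingHom.ker θ = Ideal.span {ϖ}) :
    RingHom.ker ((Spec.map (CommRingCat.ofHom θ)).app ⊤).hom = Ideal.span {(Scheme.ΓSpecIso (.of R)).inv ϖ} := by
  ext x
  rw [RingHom.mem_ker, Ideal.mem_span_singleton']
  change (Spec.map (CommRingCat.ofHom θ)).appTop x = 0 ↔ _
  rw [appTop_specMap_eq_zero_iff]
  change θ ((Scheme.ΓSpecIso (.of R)).hom x) = 0 ↔ _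
  rw [← RingHom.mem_ker, hker, Ideal.mem_span_singleton']
  constructor
  · rintro ⟨a, ha⟩
    refine ⟨(Scheme.ΓSpecIso (.of R)).inv a, ?_⟩
    rw [← map_mul, ha, Iso.hom_inv_id_apply]
  · rintro ⟨a, rfl⟩
    exact ⟨(Scheme.ΓSpecIso (.of R)).hom a, by rw [map_mul, Iso.inv_hom_id_apply]⟩

/-- **The kernel of `i♯` on an affine open of a model square is `(ker Spec θ)(⊤) · Γ(C, V)`**: `i` is the base change of the closed
immersion `Spec θ`, so `ker i = (ker Spec θ)·𝒪_C`, read on the small affine `V` over `⊤ ⊆ Spec O`.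
[cite: GortzWedhorn2020, Example 4.36 (p. 139)] -/
theorem ker_app_eq_map_of_isPullback {R S : Type u} [CommRing R] [CommRing S] (θ : R →+* S) (hθ : Function.Surjective θ)
    {C Ck : Scheme.{u}} (f : C ⟶ Spec (.of R)) (i : Ck ⟶ C) (t : Ck ⟶ Spec (.of S))
    (hsq : IsPullback i t f (Spec.map (CommRingCat.ofHom θ))) (V : C.affineOpens) :
    RingHom.ker (i.app V).hom =
      (RingHom.ker ((Spec.map (CommRingCat.ofHom θ)).app ⊤).hom).map (f.appLE ⊤ V le_top).hom := by
  haveI : IsClosedImmersion (Spec.map (CommRingCat.ofHom θ)) := IsClosedImmersion.spec_of_surjective _ hθ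
  haveI : IsClosedImmersion i := MorphismProperty.IsStableUnderBaseChange.of_isPullback hsq.flip inferInstance
  have hkeri : i.ker = (Spec.map (CommRingCat.ofHom θ)).ker.comap f := by
    rw [← hsq.isoPullback_hom_fst, Scheme.Hom.ker_comp_of_isIso]
    exact Scheme.IdealSheafData.ker_fst_of_isClosedImmersion _ _
  rw [← Scheme.Hom.ker_apply i V, hkeri,
    ideal_comap_eq_map_of_le f _ ⟨⊤, isAffineOpen_top _⟩ V le_top, Scheme.Hom.ker_apply]

/-- Restricting the image of a global function of the base. [folklore] -/
theorem map_appLE_top_apply {R : CommRingCat.{u}} {X : Scheme.{u}} (f : X ⟶ Spec R) {V W : X.Opens} (g : W ⟶ V)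
    (x : Γ(Spec R, ⊤)) : X.presheaf.map g.op (f.appLE ⊤ V le_top x) = f.appLE ⊤ W le_top x := by
  rw [← CommRingCat.comp_apply, Scheme.Hom.appLE_map]

/-- **(K) THE FLAT KERNEL** (res-L1-w45b-stub-3's CUT, signature verbatim): on a FLAT `O`-scheme `C` (`O` a DVR, residue map `θ : O ↠ k`,
model square `(i, t)`), a function `b` on an open `U` that vanishes on the special fibre `i⁻¹U` is `ϖ · c` for a uniformiser `ϖ ∈ 𝔪_O` and a
function `c` on `U`. Affine-locally `ker i♯ = (ϖ)` (base change of `Spec k ↪ Spec O`); flatness makes `ϖ` a non-zero-divisor on all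
sections, so the local quotients are unique and glue. [cite: StacksProject, Tag 00HI] [cite: GortzWedhorn2020, Example 4.36 (p. 139)]
[OURS · L1 W4.5b] helper toward F-102 / stmt-ResolutionOfSingularities-20148; NOT a statement of the manuscript. -/
theorem exists_eq_varpi_mul_of_appLE_eq_zero (O : Type) [CommRing O] [IsDomain O] [IsDiscreteValuationRing O] (k : Type) [Field k]
    (θ : O →+* k) (hθ : Function.Surjective θ) {C Ck : Scheme.{0}} (f : C ⟶ Spec (.of O)) [Flat f] (i : Ck ⟶ C)
    (t : Ck ⟶ Spec (.of k)) (hsq : IsPullback i t f (Spec.map (CommRingCat.ofHom θ))) (U : C.Opens) (b : Γ(C, U))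
    (hb : i.appLE U (i ⁻¹ᵁ U) le_rfl b = 0) :
    ∃ (ϖ : O) (c : Γ(C, U)), ϖ ∈ maximalIdeal O ∧ b = (f.app ⊤ ((Scheme.ΓSpecIso (.of O)).inv ϖ) |_ U) * c := by
  classical
  -- a uniformiser `ϖ`: `𝔪_O = (ϖ) = ker θ`
  obtain ⟨ϖ, hϖ⟩ := IsDiscreteValuationRing.exists_irreducible O
  have hmax : maximalIdeal O = Ideal.span {ϖ} := hϖ.maximalIdeal_eq
  have hϖm : ϖ ∈ maximalIdeal O := by rw [hmax]; exact Ideal.mem_span_singleton_self ϖ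
  have hkerθ : RingHom.ker θ = Ideal.span {ϖ} :=
    (IsLocalRing.eq_maximalIdeal (RingHom.ker_isMaximal_of_surjective θ hθ)).trans hmax
  set tO : Γ(Spec (.of O), ⊤) := (Scheme.ΓSpecIso (.of O)).inv ϖ with htO_def
  have htO : IsRegular tO :=
    isRegular_of_isRegular_ΓSpecIso tO (by rw [htO_def, Iso.inv_hom_id_apply]; exact IsRegular.of_ne_zero hϖ.ne_zero)
  have hK : RingHom.ker ((Spec.map (CommRingCat.ofHom θ)).app ⊤).hom = Ideal.span {tO} := ker_appTop_specMap_eq_span θ ϖ hkerθ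
  -- on an affine `V`: `ker i♯ = (ϖ_V)`
  have hkerV : ∀ V : C.affineOpens, RingHom.ker (i.app V).hom = Ideal.span {f.appLE ⊤ V le_top tO} := by
    intro V
    rw [ker_app_eq_map_of_isPullback θ hθ f i t hsq V, hK, Ideal.map_span, Set.image_singleton]
  -- `b|_V` is killed by `i♯`
  have hbV : ∀ (V : C.affineOpens) (hVU : (V : C.Opens) ≤ U), (i.app V).hom (C.presheaf.map (homOfLE hVU).op b) = 0 := by
    intro V hVU
    have hle : i ⁻¹ᵁ (V : C.Opens) ≤ i ⁻¹ᵁ U := fun x hx => hVU hx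
    have h1 : (i.app V).hom (C.presheaf.map (homOfLE hVU).op b) =
        Ck.presheaf.map (homOfLE hle).op (i.appLE U (i ⁻¹ᵁ U) le_rfl b) := by
      rw [Scheme.Hom.app_eq_appLE, ← CommRingCat.comp_apply, ← CommRingCat.comp_apply, Scheme.Hom.map_appLE,
        Scheme.Hom.appLE_map]
    rw [h1, hb, map_zero]
  -- existence of the local quotient on an affine `V ≤ U`
  have hexV : ∀ (V : C.affineOpens) (hVU : (V : C.Opens) ≤ U),
      ∃ c : Γ(C, V), C.presheaf.map (homOfLE hVU).op b = f.appLE ⊤ V le_top tO * c := by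
    intro V hVU
    have hmem : C.presheaf.map (homOfLE hVU).op b ∈ RingHom.ker (i.app V).hom := hbV V hVU
    rw [hkerV V, Ideal.mem_span_singleton'] at hmem
    obtain ⟨c, hc⟩ := hmem
    exact ⟨c, by rw [← hc, mul_comm]⟩
  -- uniqueness of quotients by `ϖ` on ANY open (flatness)
  have huniq : ∀ (W : C.Opens) (c c' : Γ(C, W)), f.appLE ⊤ W le_top tO * c = f.appLE ⊤ W le_top tO * c' → c = c' := by
    intro W c c' h
    have h0 : f.appLE ⊤ W le_top tO * (c - c') = 0 := by rw [mul_sub, h, sub_self]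
    exact sub_eq_zero.mp (eq_zero_of_appLE_mul_eq_zero f W htO le_top _ h0)
  -- glue over the affine opens of `U`
  let ι := {V : C.affineOpens // (V : C.Opens) ≤ U}
  let Uc : ι → C.Opens := fun V => (V.1 : C.Opens)
  choose sf hsf using fun V : ι => hexV V.1 V.2
  have hcover : U ≤ iSup Uc := by
    intro x hx
    obtain ⟨_, ⟨V, hV, rfl⟩, hxV, hVU⟩ := C.isBasis_affineOpens.exists_subset_of_mem_open hx U.2
    exact Opens.mem_iSup.mpr ⟨⟨⟨V, hV⟩, hVU⟩, hxV⟩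
  have hrestr : ∀ (V : ι) {W : C.Opens} (g : W ⟶ Uc V) (hWU : W ≤ U),
      f.appLE ⊤ W le_top tO * C.presheaf.map g.op (sf V) = C.presheaf.map (homOfLE hWU).op b := by
    intro V W g hWU
    have e1 : C.presheaf.map g.op (C.presheaf.map (homOfLE V.2).op b) = C.presheaf.map (homOfLE hWU).op b := by
      rw [← CommRingCat.comp_apply, ← Functor.map_comp]
      rfl
    rw [← e1, hsf V, map_mul, map_appLE_top_apply]
  have hcompat : TopCat.Presheaf.IsCompatible C.presheaf Uc sf := by
    intro V W
    apply huniq (Uc V ⊓ Uc W)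
    rw [hrestr V (Opens.infLELeft (Uc V) (Uc W)) (inf_le_left.trans V.2),
      hrestr W (Opens.infLERight (Uc V) (Uc W)) (inf_le_left.trans V.2)]
  obtain ⟨c, hc, -⟩ : ∃! s : Γ(C, U), ∀ V : ι, C.presheaf.map (homOfLE V.2).op s = sf V :=
    C.sheaf.existsUnique_gluing' Uc U (fun V => homOfLE V.2) hcover sf hcompat
  refine ⟨ϖ, c, hϖm, ?_⟩
  have hϖU : (f.app ⊤ tO |_ U) = f.appLE ⊤ U le_top tO := rfl
  rw [hϖU]
  refine C.sheaf.eq_of_locally_eq' Uc U (fun V => homOfLE V.2) hcover b (f.appLE ⊤ U le_top tO * c) fun V => ?_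
  change C.presheaf.map (homOfLE V.2).op b = C.presheaf.map (homOfLE V.2).op (f.appLE ⊤ U le_top tO * c)
  rw [map_mul, map_appLE_top_apply, show C.presheaf.map (homOfLE V.2).op c = sf V from hc V]
  exact hsf V

end Summit.ResolutionOfSingularities.ResolutionOfSingularities.Cruxes.EquisingularLiftNat.F102

end
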